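import Summits.Ventures.PercRepro2.CaseOneNullEdgeClasses

/-!
# Every statement vertex whose neighbours are all marks is closed (blind cell PercRepro2, p1 g29;
S5 §2.3, the all-marked base of the rung in the kernel at every multiplicity)

**`closedAt_of_marksOnly`**: if every edge at the statement vertex `a₃` goes to one of the four marks
`a₁, a₂, o, b` — any multiplicities, any coincidences among the marks, `a₃` itself possibly a mark —
then `a₃` is closed: all four forms `(ii)`, `(ii-Q)`, `(i)`, `(i-Q)` for every weight vector. The
proof: extend `G` by four null edges `a₃ ~ a₁, a₂, o, b` (`extEnds`, `closedAt_of_ext` ×4); in the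
extension every old edge at `a₃` is parallel to one of the four new ones, and the strong induction
**`closedAt_of_fourStar_aux`** merges them one by one (`ThickStep.par`, `closedAt_of_thickStep`) down
to the marked star on the four new edges, a closed anchor (`closedAt_of_closedAnchor`); a statement
vertex that is a mark is closed outright (`MarkAnchor`). Every class of the S5 table with all
neighbours marked — the marked star, roots-only, roots-and-`o`, roots-and-`b`, and every sub-star at
every multiplicity — is an instance. Own code; standard axioms.
-/

namespace Summit.Ventures.PercRepro2

namespace CaseOne

universe u

section FourStar
variable {V : Type*} [Fintype V] [DecidableEq V] {R : Type*} [Field R] [LinearOrder R]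
  [IsStrictOrderedRing R]
variable {o a₁ a₂ a₃ b : V}

/-- **The four-star induction**: a graph with four distinct edges `x₁, x₂, xo, xb` at `a₃` to
`a₁, a₂, o, b` in which every edge at `a₃` is parallel to one of them is closed — merge the other
edges at `a₃` one by one (strong induction on the number of edges) down to the marked star. -/
theorem closedAt_of_fourStar_aux (h1 : a₁ ≠ a₃) (h2 : a₂ ≠ a₃) (ho : o ≠ a₃) (hb : b ≠ a₃) :
    ∀ (n : ℕ) (E : Type u) [Fintype E] [DecidableEq E] (ends : E → Sym2 V) (x₁ x₂ xo xb : E),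
      Fintype.card E = n → ends x₁ = s(a₁, a₃) → ends x₂ = s(a₂, a₃) → ends xo = s(o, a₃) →
      ends xb = s(b, a₃) → x₁ ≠ x₂ → x₁ ≠ xo → x₁ ≠ xb → x₂ ≠ xo → x₂ ≠ xb → xo ≠ xb →
      (∀ e, a₃ ∈ ends e →
        ends e = s(a₁, a₃) ∨ ends e = s(a₂, a₃) ∨ ends e = s(o, a₃) ∨ ends e = s(b, a₃)) →
      ClosedAt R o a₁ a₂ b E ends a₃ := by
  intro n
  induction n using Nat.strong_induction_on with
  | _ n ih =>
    intro E _ _ ends x₁ x₂ xo xb hn hx₁ hx₂ hxo hxb h12 h1o h1b h2o h2b hob hmarks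
    by_cases hex : ∃ e, a₃ ∈ ends e ∧ e ≠ x₁ ∧ e ≠ x₂ ∧ e ≠ xo ∧ e ≠ xb
    · -- an edge at `a₃` other than the four: parallel to one of them, merge it
      obtain ⟨e, he, he1, he2, heo, heb⟩ := hex
      have hlt : Fintype.card {f : E // f ≠ e} < n :=
        hn ▸ Fintype.card_subtype_lt (x := e) (by simp)
      have hsub : ClosedAt R o a₁ a₂ b {f : E // f ≠ e} (restrictEnds ends e) a₃ :=
        ih _ hlt {f : E // f ≠ e} (restrictEnds ends e) ⟨x₁, he1.symm⟩ ⟨x₂, he2.symm⟩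
          ⟨xo, heo.symm⟩ ⟨xb, heb.symm⟩ rfl hx₁ hx₂ hxo hxb (by simp [h12]) (by simp [h1o])
          (by simp [h1b]) (by simp [h2o]) (by simp [h2b]) (by simp [hob])
          (fun f hf => hmarks f.1 hf)
      rcases hmarks e he with h | h | h | h
      · exact closedAt_of_thickStep (ThickStep.par E ends x₁ e (hx₁.trans h.symm) he1.symm) hsub
      · exact closedAt_of_thickStep (ThickStep.par E ends x₂ e (hx₂.trans h.symm) he2.symm) hsub
      · exact closedAt_of_thickStep (ThickStep.par E ends xo e (hxo.trans h.symm) heo.symm) hsub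
      · exact closedAt_of_thickStep (ThickStep.par E ends xb e (hxb.trans h.symm) heb.symm) hsub
    · -- the four edges are the only edges at `a₃`: the marked star
      push Not at hex
      refine closedAt_of_closedAnchor o a₁ a₂ b E ends a₃ (Or.inr (Or.inl ⟨x₁, x₂, xo, xb, ?_⟩))
      exact
        { ends_1 := hx₁
          ends_2 := hx₂
          ends_o := hxo
          ends_b := hxb
          ne_12 := h12
          ne_1o := h1o
          ne_1b := h1b
          ne_2o := h2o
          ne_2b := h2b
          ne_ob := hob
          unique := fun e he => by
            by_cases h1' : e = x₁
            · exact Or.inl h1'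
            by_cases h2' : e = x₂
            · exact Or.inr (Or.inl h2')
            by_cases ho' : e = xo
            · exact Or.inr (Or.inr (Or.inl ho'))
            exact Or.inr (Or.inr (Or.inr (hex e he h1' h2' ho')))
          ne_a1 := h1
          ne_a2 := h2
          ne_o := ho
          ne_b := hb }

/-- **A statement vertex `a₃ ∉ {a₁, a₂, o, b}` all of whose edges go to marks is closed**: four null
edges to the marks, then the four-star induction. -/
theorem closedAt_of_marksOnly' {E : Type u} [Fintype E] [DecidableEq E] {ends : E → Sym2 V}
    (hmarks : ∀ e, a₃ ∈ ends e →
      ends e = s(a₁, a₃) ∨ ends e = s(a₂, a₃) ∨ ends e = s(o, a₃) ∨ ends e = s(b, a₃))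
    (h1 : a₁ ≠ a₃) (h2 : a₂ ≠ a₃) (ho : o ≠ a₃) (hb : b ≠ a₃) : ClosedAt R o a₁ a₂ b E ends a₃ := by
  refine closedAt_of_ext (s := s(b, a₃)) (closedAt_of_ext (s := s(o, a₃))
    (closedAt_of_ext (s := s(a₂, a₃)) (closedAt_of_ext (s := s(a₁, a₃)) ?_)))
  refine closedAt_of_fourStar_aux h1 h2 ho hb _ _ _ none (some none) (some (some none))
    (some (some (some none))) rfl rfl rfl rfl rfl (by simp) (by simp) (by simp) (by simp) (by simp)
    (by simp) ?_
  intro e he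
  rcases e with _ | _ | _ | _ | e
  · exact Or.inl rfl
  · exact Or.inr (Or.inl rfl)
  · exact Or.inr (Or.inr (Or.inl rfl))
  · exact Or.inr (Or.inr (Or.inr rfl))
  · exact hmarks e he

/-- **Every statement vertex whose neighbours are all marks is closed** — any multiplicities, any
coincidences among the marks, the statement vertex itself possibly a mark. -/
theorem closedAt_of_marksOnly {E : Type u} [Fintype E] [DecidableEq E] {ends : E → Sym2 V}
    (hmarks : ∀ e, a₃ ∈ ends e →
      ends e = s(a₁, a₃) ∨ ends e = s(a₂, a₃) ∨ ends e = s(o, a₃) ∨ ends e = s(b, a₃)) :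
    ClosedAt R o a₁ a₂ b E ends a₃ := by
  by_cases h1 : a₁ = a₃
  · exact closedAt_of_closedAnchor o a₁ a₂ b E ends a₃ (Or.inl (Or.inr (Or.inl h1.symm)))
  by_cases h2 : a₂ = a₃
  · exact closedAt_of_closedAnchor o a₁ a₂ b E ends a₃ (Or.inl (Or.inr (Or.inr (Or.inl h2.symm))))
  by_cases ho : o = a₃
  · exact closedAt_of_closedAnchor o a₁ a₂ b E ends a₃ (Or.inl (Or.inl ho.symm))
  by_cases hb : b = a₃
  · exact closedAt_of_closedAnchor o a₁ a₂ b E ends a₃ (Or.inl (Or.inr (Or.inr (Or.inr hb.symm))))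
  exact closedAt_of_marksOnly' hmarks h1 h2 ho hb

/-- All four forms for one weight vector at a statement vertex whose neighbours are all marks. -/
theorem fourForms_of_marksOnly {E : Type u} [Fintype E] [DecidableEq E] {ends : E → Sym2 V}
    (p : E → R) (hp : IsProbVec p) (hmarks : ∀ e, a₃ ∈ ends e →
      ends e = s(a₁, a₃) ∨ ends e = s(a₂, a₃) ∨ ends e = s(o, a₃) ∨ ends e = s(b, a₃)) :
    FourForms p ends o a₁ a₂ a₃ b :=
  closedAt_of_marksOnly hmarks p hp

/-- **Every instance reachable by moves from a marks-only statement vertex is closed.** -/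
theorem closedAt_of_moves_marksOnly {E' : Type u} [Fintype E'] [DecidableEq E'] {ends' : E' → Sym2 V}
    {v' : V} (hmarks : ∀ e, v' ∈ ends' e →
      ends' e = s(a₁, v') ∨ ends' e = s(a₂, v') ∨ ends' e = s(o, v') ∨ ends' e = s(b, v'))
    {E : Type u} [Fintype E] [DecidableEq E] {ends : E → Sym2 V} {v : V}
    (h : Moves o a₁ a₂ b E' ends' v' E ends v) : ClosedAt R o a₁ a₂ b E ends v :=
  closedAt_of_moves h (closedAt_of_marksOnly hmarks)

end FourStar

end CaseOne

end Summit.Ventures.PercRepro2
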